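import Mathlib
import Summits.AtomisticToContinuum.Crystallization.Theses.PhononSlackCertificates
import Summits.AtomisticToContinuum.Crystallization.Theorems.PhononSlackCertificatesNearFieldConvexityStubCruxOfPureNearField
import Summits.AtomisticToContinuum.Crystallization.Theorems.PhononSlackCertificatesNearFieldConvexityStubPnfOfLocalCertificate
import Summits.AtomisticToContinuum.Crystallization.Theorems.PhononSlackCertificatesNearFieldConvexityLayeredThreshold

/-!
# Route `PhononSlackCertificates`, crux `NearFieldConvexity` (stmt-AtomisticToContinuum-13958), line `Sketch`:
the CHEBYSHEV REDUCTION of the perturbative stub `stub_perturbativeCoercivity` (piece P1)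

The perturbative half (I_band) of the energy estimate of skeleton v21 asks, for SOME goodness tolerance
`ε₁ ∈ [1/100, 1/20]` and all `δ, η > 0`, for constants `c > 0`, `C` with

`c · #{i ∈ int₈Ω : the 2-ball of x i is NOT η-layered} ≤ [E_self(Ω) − |Ω|·e*] + C · #∂₄Ω`

on every `δ`-separated configuration and every finite set `Ω` of `ε₁`-good particles carrying `2/5`-charts at its
radius-3 interior sites.  This file proves that (I_band) follows from the SUMMED SQUARED THRESHOLD estimate (I_sq):

`Σ_{i ∈ int₈Ω} θ(i)² ≤ K · [E_self(Ω) − |Ω|·e*] + C · #∂₄Ω`, `K ≥ 0`,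

where `θ(i) = sInf {e ≥ 0 : the 2-ball of x i is e-layered}` is the layeredness threshold (toolkit
`…NearFieldConvexityLayeredThreshold`).  The proof is Chebyshev's inequality: at a non-`η`-layered site `η ≤ θ(i)`
(`threshold_ge_of_not_layered`), so `η² · #{…} ≤ Σ θ²`; the constants are `c = η²/(K+1)`, `C' = C/(K+1)`, using the
periodisation floor `0 ≤ E_self(Ω) − |Ω|·e*` (`pureNearField_self_floor`) to absorb `K/(K+1) ≤ 1`.  `[folklore]`.
-/

noncomputable section

open scoped BigOperators
open Literature.MathematicalPhysics.StatisticalMechanics Literature.Geometry.DiscreteGeometry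

namespace Summit.AtomisticToContinuum.Crystallization.Theorems.PhononSlackNearFieldConvexity

/-- **Registered piece `stub_perturbativeOfThreshold` (P1 of `stub_perturbativeCoercivity`, CHEBYSHEV REDUCTION).**
If for some `ε₁ ∈ [1/100, 1/20]` the summed squared layeredness threshold over the radius-8 interior of every finite
set `Ω` of `ε₁`-good particles (of a `δ`-separated configuration, with `2/5`-charts at the radius-3 interior sites) is
paid linearly by the excess, `Σ_{i∈int₈Ω} θ(i)² ≤ K·[E_self(Ω) − |Ω|e*] + C·#∂₄Ω` with `K ≥ 0`, then (I_band) holds: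
for all `δ, η > 0` there are `c > 0`, `C'` with `c·#{i ∈ int₈Ω : not η-layered} ≤ [E_self(Ω) − |Ω|e*] + C'·#∂₄Ω`
(`c = η²/(K+1)`, `C' = C/(K+1)`). [folklore] -/
theorem stub_perturbativeOfThreshold : (∃ ε₁ : ℝ, 1 / 100 ≤ ε₁ ∧ ε₁ ≤ 1 / 20 ∧ ∀ δ : ℝ, 0 < δ → ∃ K : ℝ, 0 ≤ K ∧ ∃ C : ℝ, ∀ (N : ℕ) (x : Fin N → EuclideanSpace ℝ (Fin 3)), (∀ i j : Fin N, i ≠ j → δ ≤ dist (x i) (x j)) → ∀ Ω : Finset (Fin N), (∀ i ∈ Ω, IsTwoShellGood ε₁ (47 / 50) 1 x i) → (∀ i ∈ Ω, (∀ k : Fin N, dist (x k) (x i) ≤ 3 → k ∈ Ω) → (∃ (A : EuclideanSpace ℝ (Fin 3) →ₗᵢ[ℝ] EuclideanSpace ℝ (Fin 3)) (a h : ℝ) (s : ℤ → ℤ), 47 / 50 ≤ a ∧ a ≤ 1 ∧ 39 / 50 * a ≤ h ∧ h ≤ 17 / 20 * a ∧ IsHaggSeq s ∧ (fun S : Set (EuclideanSpace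 ℝ (Fin 3)) => (∀ j : Fin N, dist (x j) (x i) ≤ 2 → ∃ p ∈ S, dist (x j) p ≤ 2 / 5) ∧ (∀ p ∈ S, dist p (x i) ≤ 2 → ∃ j : Fin N, dist (x j) p ≤ 2 / 5)) {p | ∃ m u v : ℤ, p = x i + A (((u : ℝ) • triangularVec₁ a) + ((v : ℝ) • triangularVec₂ a) + ((haggLabel s m : ℝ) • barlowOffset a) + ((m : ℝ) • layerNormal h))})) → (∑ i ∈ Ω.filter (fun i => ∀ k : Fin N, dist (x k) (x i) ≤ 8 → k ∈ Ω), (sInf {e : ℝ | 0 ≤ e ∧ (∃ (A : EuclideanSpace ℝ (Fin 3) →ₗᵢ[ℝ] EuclideanSpace ℝ (Fin 3)) (t : EuclideanSpace ℝ (Fin 3)) (a : ℝ) (s : ℤ → ℤ) (z : ℤ → ℝ), 47 / 50 ≤ a ∧ a ≤ 1 ∧ IsHaggSeq s ∧ (∀ m : ℤ, 39 / 50 * a ≤ z (m + 1) - z m ∧ z (m + 1) - z m ≤ 17 / 20 * a) ∧ (fun S : Set (EuclideanSpace ℝ (Fin 3)) => (∀ j : Fin N, dist (x j) (x i) ≤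 2 → ∃ p ∈ S, dist (x j + t) p ≤ e) ∧ (∀ p ∈ S, dist p (x i + t) ≤ 2 → ∃ j : Fin N, dist (x j + t) p ≤ e)) {p | ∃ m i j : ℤ, p = A (((i : ℝ) • triangularVec₁ a) + ((j : ℝ) • triangularVec₂ a) + ((haggLabel s m : ℝ) • barlowOffset a) + (z m • layerNormal 1))})}) ^ 2) ≤ K * ((∑ i ∈ Ω, (1 / 2 : ℝ) * (∑ j ∈ Ω.erase i, lennardJones (dist (x i) (x j)))) - (Ω.card : ℝ) * (⨅ Q : PeriodicConfiguration 3, Q.energyPerParticle lennardJones)) + C * (Nat.card {i : Fin N // i ∈ Ω ∧ ∃ j : Fin N, j ∉ Ω ∧ dist (x j) (x i) ≤ 4} : ℝ)) → ∃ ε₁ : ℝ, 1 / 100 ≤ ε₁ ∧ ε₁ ≤ 1 / 20 ∧ ∀ δ : ℝ, 0 < δ → ∀ η : ℝ, 0 < η → ∃ c : ℝ, 0 < c ∧ ∃ C : ℝ, ∀ (N : ℕ) (x : Fin N → EuclideanSpace ℝ (Fin 3)), (∀ i j : Fin N, i ≠ j → δ ≤ dist (x i) (x j)) → ∀ Ω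 : Finset (Fin N), (∀ i ∈ Ω, IsTwoShellGood (ε₁) (47 / 50) 1 x i) → (∀ i ∈ Ω, (∀ k : Fin N, dist (x k) (x i) ≤ 3 → k ∈ Ω) → (∃ (A : EuclideanSpace ℝ (Fin 3) →ₗᵢ[ℝ] EuclideanSpace ℝ (Fin 3)) (a h : ℝ) (s : ℤ → ℤ), 47 / 50 ≤ a ∧ a ≤ 1 ∧ 39 / 50 * a ≤ h ∧ h ≤ 17 / 20 * a ∧ IsHaggSeq s ∧ (fun S : Set (EuclideanSpace ℝ (Fin 3)) => (∀ j : Fin N, dist (x j) (x i) ≤ 2 → ∃ p ∈ S, dist (x j) p ≤ 2 / 5) ∧ (∀ p ∈ S, dist p (x i) ≤ 2 → ∃ j : Fin N, dist (x j) p ≤ 2 / 5)) {p | ∃ m u v : ℤ, p = x i + A (((u : ℝ) • triangularVec₁ a) + ((v : ℝ) • triangularVec₂ a) + ((haggLabel s m : ℝ) • barlowOffset a) + ((m : ℝ) • layerNormal h))})) → c * (Nat.card {i : Fin N // i ∈ Ω ∧ ((∀ k : Fin N, dist (x k) (x i) ≤ 8 → k ∈ Ω) ∧ ¬ (∃ (A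 : EuclideanSpace ℝ (Fin 3) →ₗᵢ[ℝ] EuclideanSpace ℝ (Fin 3)) (t : EuclideanSpace ℝ (Fin 3)) (a : ℝ) (s : ℤ → ℤ) (z : ℤ → ℝ), 47 / 50 ≤ a ∧ a ≤ 1 ∧ IsHaggSeq s ∧ (∀ m : ℤ, 39 / 50 * a ≤ z (m + 1) - z m ∧ z (m + 1) - z m ≤ 17 / 20 * a) ∧ (fun S : Set (EuclideanSpace ℝ (Fin 3)) => (∀ j : Fin N, dist (x j) (x i) ≤ 2 → ∃ p ∈ S, dist (x j + t) p ≤ η) ∧ (∀ p ∈ S, dist p (x i + t) ≤ 2 → ∃ j : Fin N, dist (x j + t) p ≤ η)) {p | ∃ m i j : ℤ, p = A (((i : ℝ) • triangularVec₁ a) + ((j : ℝ) • triangularVec₂ a) + ((haggLabel s m : ℝ) • barlowOffset a) + (z m • layerNormal 1))}))} : ℝ) ≤ ((∑ i ∈ Ω, (1 / 2 : ℝ) * (∑ j ∈ Ω.erase i, lennardJones (dist (x i) (x j)))) - (Ω.card : ℝ) * (⨅ Q : PeriodicConfiguration 3, Q.energyPerParticle lennardJones)) + C * (Nat.card {i :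 Fin N // i ∈ Ω ∧ ∃ j : Fin N, j ∉ Ω ∧ dist (x j) (x i) ≤ 4} : ℝ) := by
  rintro ⟨ε₁, hε₁, hε₁', hsq⟩
  refine ⟨ε₁, hε₁, hε₁', ?_⟩
  intro δ hδ η hη
  obtain ⟨K, hK, C, hC⟩ := hsq δ hδ
  have hK1 : 0 < K + 1 := by linarith
  refine ⟨η ^ 2 / (K + 1), by positivity, C / (K + 1), ?_⟩
  intro N x hsep Ω hΩ hchart
  classical
  have hsum := hC N x hsep Ω hΩ hchart
  have hfloor := pureNearField_self_floor x hδ hsep Ω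
  -- rewrite the `Nat.card`s as filter cards
  rw [lc_natCard_eq, lc_natCard_eq]
  rw [lc_natCard_eq] at hsum
  -- abbreviations (verbatim copies of the inline expressions)
  set θ : Fin N → ℝ := fun i => sInf {e : ℝ | 0 ≤ e ∧ (∃ (A : EuclideanSpace ℝ (Fin 3) →ₗᵢ[ℝ] EuclideanSpace ℝ (Fin 3)) (t : EuclideanSpace ℝ (Fin 3)) (a : ℝ) (s : ℤ → ℤ) (z : ℤ → ℝ), 47 / 50 ≤ a ∧ a ≤ 1 ∧ IsHaggSeq s ∧ (∀ m : ℤ, 39 / 50 * a ≤ z (m + 1) - z m ∧ z (m + 1) - z m ≤ 17 / 20 * a) ∧ (fun S : Set (EuclideanSpace ℝ (Fin 3)) => (∀ j : Fin N, dist (x j) (x i) ≤ 2 → ∃ p ∈ S, dist (x j + t) p ≤ e) ∧ (∀ p ∈ S, dist p (x i + t) ≤ 2 → ∃ j : Fin N, dist (x j + t) p ≤ e)) {p | ∃ m i j : ℤ, p = A (((i : ℝ) • triangularVec₁ a) + ((j : ℝ) • triangularVec₂ a) + ((haggLabel s m : ℝ) • barlowOffset a) + (z m • layerNormal 1))})}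 with hθ
  set S : Finset (Fin N) := Ω.filter (fun i => (∀ k : Fin N, dist (x k) (x i) ≤ 8 → k ∈ Ω) ∧ ¬ (∃ (A : EuclideanSpace ℝ (Fin 3) →ₗᵢ[ℝ] EuclideanSpace ℝ (Fin 3)) (t : EuclideanSpace ℝ (Fin 3)) (a : ℝ) (s : ℤ → ℤ) (z : ℤ → ℝ), 47 / 50 ≤ a ∧ a ≤ 1 ∧ IsHaggSeq s ∧ (∀ m : ℤ, 39 / 50 * a ≤ z (m + 1) - z m ∧ z (m + 1) - z m ≤ 17 / 20 * a) ∧ (fun S : Set (EuclideanSpace ℝ (Fin 3)) => (∀ j : Fin N, dist (x j) (x i) ≤ 2 → ∃ p ∈ S, dist (x j + t) p ≤ η) ∧ (∀ p ∈ S, dist p (x i + t) ≤ 2 → ∃ j : Fin N, dist (x j + t) p ≤ η)) {p | ∃ m i j : ℤ, p = A (((i : ℝ) • triangularVec₁ a) + ((j : ℝ) • triangularVec₂ a) + ((haggLabel s m : ℝ) • barlowOffset a) + (z m • layerNormal 1))})) with hS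
  set I8 : Finset (Fin N) := Ω.filter (fun i => ∀ k : Fin N, dist (x k) (x i) ≤ 8 → k ∈ Ω) with hI8
  set b4 : ℝ := ((Ω.filter fun i => ∃ j : Fin N, j ∉ Ω ∧ dist (x j) (x i) ≤ 4).card : ℝ) with hb4
  set ex : ℝ := (∑ i ∈ Ω, (1 / 2 : ℝ) * (∑ j ∈ Ω.erase i, lennardJones (dist (x i) (x j)))) - (Ω.card : ℝ) * (⨅ Q : PeriodicConfiguration 3, Q.energyPerParticle lennardJones) with hex
  -- the summed squared threshold estimate, restated with the abbreviation `θ`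
  have hsum' : ∑ i ∈ I8, θ i ^ 2 ≤ K * ex + C * b4 := hsum
  -- Chebyshev: `η² · #S ≤ Σ_S θ² ≤ Σ_{int₈Ω} θ²`
  have hSsub : S ⊆ I8 := by
    intro i hi
    rw [hS, Finset.mem_filter] at hi
    rw [hI8, Finset.mem_filter]
    exact ⟨hi.1, hi.2.1⟩
  have h1 : ∑ i ∈ S, θ i ^ 2 ≤ ∑ i ∈ I8, θ i ^ 2 :=
    Finset.sum_le_sum_of_subset_of_nonneg hSsub fun i _ _ => sq_nonneg (θ i)
  have h2 : ∑ i ∈ S, η ^ 2 ≤ ∑ i ∈ S, θ i ^ 2 := by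
    refine Finset.sum_le_sum fun i hi => ?_
    rw [hS, Finset.mem_filter] at hi
    exact pow_le_pow_left₀ hη.le (threshold_ge_of_not_layered x i hi.2.2) 2
  have h3 : ∑ i ∈ S, η ^ 2 = η ^ 2 * (S.card : ℝ) := by
    rw [Finset.sum_const, nsmul_eq_mul, mul_comm]
  have hkey : η ^ 2 * (S.card : ℝ) ≤ K * ex + C * b4 := by linarith [h1, h2, h3, hsum']
  -- constants
  rw [div_mul_eq_mul_div, div_le_iff₀ hK1]
  have e : (ex + C / (K + 1) * b4) * (K + 1) = (K + 1) * ex + C * b4 := by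
    field_simp
  rw [e]
  nlinarith [hkey, hfloor, hK]

end Summit.AtomisticToContinuum.Crystallization.Theorems.PhononSlackNearFieldConvexity
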